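/-
Copyright (c) 2026 the pub-hodgecm-mathlib formalisation cell (harness21).  Prover seat hodgecm-mathlib-B-p04 (g61), req618 STAGE 1a «FOUR-FRAME» squad, unit (i) tier-2
support: the `[IsPrincipalIdealRing 𝒪[K]]` hypothesis of the ★ `UnitaryLatticeTree*` kit DISCHARGED for every `ℤᵐ⁰`-valued field.  2026-09-03.
-/
import Literature.Algebra.EuclideanDomain.UniversalSideDivisors     -- ★ `isPrincipalIdealRing_of_euclideanFunction` (Alaca–Williams Thm. 2.1.2 in Euclidean-function form)
import Mathlib.Topology.Algebra.Valued.ValuedField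
import HarnessLib

/-!
# The valuation ring `𝒪[K]` of a `ℤᵐ⁰`-valued field is a principal ideal ring (Serre, *Local Fields* II §2; Alaca–Williams Thm. 2.1.2)

Topic `RingTheory/DiscreteValuationRing`; namespace `Literature.RingTheory.DiscreteValuationRing`.  THEOREM ONLY (no definition, no instance, no notation, no named fact,
no `sorry`).  For ANY field `K` with `Valued K ℤᵐ⁰` (no uniformiser, no completeness needed): the Euclidean function `φ(x) = (−log |x|).toNat` on `𝒪[K] = {|x| ≤ 1}` has the
division property trivially — if `|a| ≤ |b|` then `b ∣ a` (`q = a∕b ∈ 𝒪`, remainder `0`), else `q = 0`, remainder `a` with `φ(a) < φ(b)` — so ★ `isPrincipalIdealRing_of_euclideanFunction`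
applies.  CONSUMERS: the ★ `UnitaryLatticeTree*` files stated over an abstract `[Valued K ℤᵐ⁰]` carry `[IsPrincipalIdealRing 𝒪[K]]` as a hypothesis («discharged downstream by ★
`isPrincipalIdealRing_integer_adicCompletion`» at CM completions); with this file it is discharged at EVERY `ℤᵐ⁰`-valued field — in particular inside the tier-2 proofs of the
(D-RAM) «FOUR-FRAME» road's unit (i) (A-2↓: sub-lattices `Λ ∩ T⁻¹Λ` of a framed lattice are framed), whose tier-1 statements bind only `[Valued K ℤᵐ⁰] [CompleteSpace K]`.

* **`isPrincipalIdealRing_valuedInteger`** : `IsPrincipalIdealRing 𝒪[K]`.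

HONEST LABEL (cell `pub/hodgecm-mathlib`, crux H413 = `stmt-HodgeConjecture-24833`): HC_CM is proved only modulo the 7 printed citations (2 remaining named inputs: hLiu418 =
stmt-HodgeConjecture-24832, h413 = stmt-HodgeConjecture-24833) until rung 0 closes; generic algebra, `--supports` helper.
-/

noncomputable section

open scoped Valued WithZero

namespace Literature.RingTheory.DiscreteValuationRing

open Literature.Algebra.EuclideanDomain

/-- **`𝒪[K]` IS A PRINCIPAL IDEAL RING for every `ℤᵐ⁰`-valued field `K`** (Euclidean function `φ(x) = (−log |x|).toNat`: if `|a| ≤ |b|` then `a = b·(a∕b)`, else `a = b·0 + a`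
with `φ(a) < φ(b)`). [cite: SerreLocalFields1979, Ch. II §2] [cite: AlacaWilliams2003, Thm. 2.1.2 (p. 28)] -/
theorem isPrincipalIdealRing_valuedInteger {K : Type*} [Field K] [Valued K ℤᵐ⁰] : IsPrincipalIdealRing 𝒪[K] := by
  refine isPrincipalIdealRing_of_euclideanFunction (fun x : 𝒪[K] => (-(WithZero.log (Valued.v (x : K)))).toNat) fun a b hb => ?_
  have hb0 : (b : K) ≠ 0 := fun h => hb (Subtype.ext h)
  have hvb0 : Valued.v (b : K) ≠ 0 := (Valuation.ne_zero_iff _).2 hb0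
  by_cases hab : Valued.v (a : K) ≤ Valued.v (b : K)
  · -- `b ∣ a`: quotient `a / b ∈ 𝒪`, remainder `0`
    have hq : Valued.v ((a : K) / b) ≤ 1 := by
      rw [map_div₀]
      exact (div_le_one₀ (zero_lt_iff.2 hvb0)).2 hab
    refine ⟨⟨(a : K) / b, (Valuation.mem_integer_iff _ _).2 hq⟩, 0, Subtype.ext ?_, Or.inl rfl⟩
    simp only [Subring.coe_mul, add_zero]
    rw [mul_div_cancel₀ _ hb0]
  · -- `|b| < |a|`: quotient `0`, remainder `a`, and `φ a < φ b`
    have hlt : Valued.v (b : K) < Valued.v (a : K) := lt_of_not_ge hab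
    have ha0 : Valued.v (a : K) ≠ 0 := ne_of_gt (lt_of_le_of_lt zero_le hlt)
    have hva1 : Valued.v (a : K) ≤ 1 := (Valuation.mem_integer_iff _ _).1 a.2
    refine ⟨0, a, by rw [mul_zero, zero_add], Or.inr ?_⟩
    have hlog : WithZero.log (Valued.v (b : K)) < WithZero.log (Valued.v (a : K)) := (WithZero.log_lt_log hvb0 ha0).2 hlt
    have hloga : WithZero.log (Valued.v (a : K)) ≤ 0 := by
      rw [WithZero.log_le_iff_le_exp ha0, WithZero.exp_zero]; exact hva1
    have hpos : 0 < -(WithZero.log (Valued.v (b : K))) := by omega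
    exact (Int.toNat_lt_toNat hpos).2 (by omega)

end Literature.RingTheory.DiscreteValuationRing

end
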